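import Summits.BirchSwinnertonDyer.BirchSwinnertonDyer.Theorems.PrintCf2SplitBadTwoCMPrimaryDyadicTableRelaxed
import Summits.BirchSwinnertonDyer.BirchSwinnertonDyer.Theorems.PrintCf2SplitBadTwoCMScalarAtVOfEtale
import Summits.BirchSwinnertonDyer.BirchSwinnertonDyer.Theorems.PrintCf2SplitBadTwoLocalUntwist
import Summits.BirchSwinnertonDyer.BirchSwinnertonDyer.Theorems.PrintCf2SplitBadTwoGoodCurveAtV
import Literature.NumberTheory.EllipticCurves.LocalPointsOrdinaryKummerCongruenceProofs
import Literature.NumberTheory.EllipticCurves.PoonenRainsKummerChords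
import HarnessLib

/-!
# The two local inputs of (ET-v) at the pinned place `v`: an inertia element acting as `−1` on `W*`, and the vanishing of the
# `W*`-component of Kummer cocycles on the inertia of `K_v(√d)` (Greenberg's reduction argument for the good twist)

Crux `stmt-BirchSwinnertonDyer-20368` (`PrintCf2.SplitBadTwoRankOneOfFacts`), road α, LEAD ruling (R-ET) 2026-08-29, brick (ET-v).
With `-w3 g10`'s `two_nsmul_resOfLe_kummer_eq_zero_of_localInputs` (file `PrintCf2SplitBadTwoETOfLocalInputs`) the brick reduces
to two local arithmetic inputs at `v`; this file proves them on the road-α frame (`C • W = cm7^{(d)}`, `K` imaginary quadratic,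
`2 = v·v̄`, `π² = π − 2`, root `r` PINNED at `v`: inertia acts on `W* = E[𝔮_r^∞]` through `±1`), GIVEN an inertia element
`τ₀ ∈ I_{K_v}` negating `√d` (supplied on the frame by -w2 g9's dyadic analysis; displayed here):
* `smul_eq_neg_of_sign_neg` (L1) — `τ₀` acts on `W*` as `−1` (-w2 g8's NAMED unramified type at `v`, p657782);
* `mem_eigen_of_untwist_mem_localKernelOfReduction` — THE IDENTIFICATION: a `2`-power torsion point whose image under the local
  untwisting `T : E(K̄_v) ≃ cm7_K(K̄_v)` (`exists_localUntwist`) lies in the kernel of reduction `cm7_K,₁(K̄_v)` belongs to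
  `W*′ = E[𝔮_{1−r}^∞]` (inertia squares move `E[2^∞]` into that preimage by Silverman VIII §1 on the good curve; `W*′` is
  divisible and carries the named RAMIFIED type `χ_cyc`, so `W*′` lies in the preimage; the preimage meets `W*` trivially because
  `cm7_K,₁ ∩ cm7_K[2]` is cyclic of order `2` — the ordinary point of `PrintCf2SplitBadTwoGoodCurveAtV`);
* `e_kummerCocycle_conj_eq_zero` (L2) — for `σ ∈ D_v` the commutator `j = τ₀⁻¹στ₀σ⁻¹` lies in `I_{K_v}` and fixes `√d`, so
  `jR − R ∈ T⁻¹(cm7_K,₁)` (Greenberg, LNM 1716 §2 Prop. 2.2: inertia acts trivially on the reduction of the good curve), hence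
  `e(jR − R) = 0` for the projector `e` onto `W*` killing `W*′`.
No definition, no named fact, no `sorry`. BSD is not proved by any of this.

References: [GreenbergLNM1716] §2 Props. 2.1–2.4; [SilvermanAEC2009] VII.2.1, VIII §1, X.5 Cor. 5.4; [Rubin1999] §3 Lemma 3.6 (ii),
Cor. 3.17; [Agboola2007] §6 Prop. 6.11.
-/

noncomputable section

open scoped Classical

set_option linter.dupNamespace false
set_option autoImplicit false

open NumberField IsDedekindDomain Field WeierstrassCurve
open Literature.NumberTheory.EllipticCurves Literature.NumberTheory.EllipticCurves.GreenbergSelmer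
open Literature.NumberTheory.GaloisRepresentations

namespace Summit.BirchSwinnertonDyer.BirchSwinnertonDyer.Theorems.PrintCf2.CMPrimes

open Summit.BirchSwinnertonDyer.BirchSwinnertonDyer.Theorems.PrintCf2.AdditiveAtSeven
open Summit.BirchSwinnertonDyer.BirchSwinnertonDyer.Theorems.PrintCf2.RestrictedSelmerPair
open Summit.BirchSwinnertonDyer.BirchSwinnertonDyer.Theorems.PrintCf2

variable {K : Type} [Field K] [NumberField K]

/-! ## §1 (L1): an inertia element negating `√d` acts on the pinned summand `W*` as `−1` -/

/-- **(L1).** On the road-α frame at the pinned place `v`, an element `τ₀ ∈ I_{K_v}` with `τ₀(√d) = −√d` acts on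
`W* = E[𝔮_r^∞]` as `−1` (the named unramified type of -w2 g8: `σ` acts on `W*[2^k]` as `s(σ)·αⁿ`, `s` the sign of `σ` on `√d`,
`n` its Frobenius degree). [cite: Rubin1999, §3 Lemma 3.6 (ii) and Cor. 3.17] [cite: Agboola2007, §6 Prop. 6.11] -/
theorem smul_eq_neg_of_sign_neg {d : ℤ} (hd0 : d ≠ 0) (W : WeierstrassCurve ℚ) [W.IsElliptic] (C : VariableChange ℚ)
    (hCW : C • W = cm7.quadraticTwist (d : ℚ)) (hK : IsImaginaryQuadratic K) {v vbar : HeightOneSpectrum (𝓞 K)}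
    (hv : ((2 : ℕ) : 𝓞 K) ∈ v.asIdeal) (hvbar : ((2 : ℕ) : 𝓞 K) ∈ vbar.asIdeal) (hne : vbar ≠ v)
    (π : (W.baseChange K).endRing) (hrel : (π : AddMonoid.End (W.baseChange K).geomPoints) * π = π - 2)
    {r : ℤ_[2]} (hr : r * r = r - 2)
    (hpin : ∀ τ ∈ GreenbergSelmer.inertia v, ∀ x : ↥((W.baseChange K).endEigenPrimaryTorsion 2 π r), τ • x = x ∨ τ • x = -x)
    {τ₀ : absoluteGaloisGroup (v.adicCompletion K)} (hτ₀ : τ₀ ∈ absInertia (v.adicCompletion K))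
    (hsign : absGaloisRestrict K (v.adicCompletion K) τ₀ • absClosureEmbedding ℚ K (WeierstrassCurve.geomSqrt (d : ℚ)) =
      -absClosureEmbedding ℚ K (WeierstrassCurve.geomSqrt (d : ℚ)))
    (x : ↥((W.baseChange K).endEigenPrimaryTorsion 2 π r)) :
    absGaloisRestrict K (v.adicCompletion K) τ₀ • x = -x := by
  haveI : Fact (Nat.Prime 2) := ⟨Nat.prime_two⟩
  have hj : W.j = -3375 := j_eq_of_smul_eq_cm7Twist hd0 W C hCW
  obtain ⟨θ, hθ⟩ := exists_sq_eq_neg_seven_of_cmEndo_mem_endRing W K hj π hrel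
  have hdQ : (d : ℚ) ≠ 0 := by exact_mod_cast hd0
  have hcl : ∀ τ ∈ GreenbergSelmer.inertia v, ∀ x ∈ (W.baseChange K).endEigenPrimaryTorsion 2 π r, τ • x = x ∨ τ • x = -x :=
    fun τ hτ x hx ↦ by
      rcases hpin τ hτ ⟨x, hx⟩ with h | h
      · exact Or.inl (congrArg Subtype.val h)
      · exact Or.inr (congrArg Subtype.val h)
  obtain ⟨α, -, -, hUR⟩ := endEigenPrimaryTorsion_two_localTypes_named_of_pinned W K hj hθ π hrel hr hdQ C hCW v hv
    (inertiaDeg_eq_one_of_ne_two K hK.1 hv hvbar hne) hcl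
  obtain ⟨k, hk⟩ := (AddCommGroup.mem_primaryComponent).mp (x : (W.baseChange K).geomPrimaryTorsion 2).2
  have hk' : 2 ^ k • (x : (W.baseChange K).geomPrimaryTorsion 2) = 0 :=
    Subtype.ext (by rw [AddSubmonoidClass.coe_nsmul, ZeroMemClass.coe_zero]; exact hk)
  have hτ0 : IsFrobPow τ₀ ((0 : ℕ) : ℤ) := by exact_mod_cast isFrobPow_zero_iff_mem_absInertia.mpr hτ₀
  have h := (hUR τ₀ 0 hτ0 (-1) (Or.inr ⟨hsign, rfl⟩)).1 k x x.2 hk' (-1)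
    (by rw [pow_zero, Units.val_one, Int.cast_neg, Int.cast_one, mul_one, sub_self]; exact Submodule.zero_mem _)
  rw [neg_one_zsmul] at h
  exact Subtype.ext (by rw [endEigenPrimaryTorsion.coe_smul, AddSubgroup.coe_neg]; exact h)

/-! ## §2 The identification `T⁻¹(cm7_K,₁) ∩ E[2^∞] = W*′` -/

omit [NumberField K] in
/-- Every `K_v`-automorphism of `K̄_v` sends a square root `θ` of the rational number `d` to `±θ`. [folklore] -/
theorem restrictScalars_apply_sqrt_eq_or {E : Type} [Field E] [Algebra K E] {d : ℤ} {θ : AlgebraicClosure E}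
    (hθ : θ ^ 2 = algebraMap K (AlgebraicClosure E) d) (g : absoluteGaloisGroup E) :
    (AlgEquiv.restrictScalars K (show AlgebraicClosure E ≃ₐ[E] AlgebraicClosure E from g)) θ = θ ∨
      (AlgEquiv.restrictScalars K (show AlgebraicClosure E ≃ₐ[E] AlgebraicClosure E from g)) θ = -θ := by
  apply sq_eq_sq_iff_eq_or_eq_neg.mp
  rw [← map_pow, hθ, AlgEquiv.commutes]

omit [NumberField K] in
/-- Every commutator-type word `a⁻¹ b a b⁻¹` of `K_v`-automorphisms fixes a square root `θ` of a rational number (each letter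
acts on `θ` by a sign). [folklore] -/
theorem restrictScalars_conjWord_apply_sqrt {E : Type} [Field E] [Algebra K E] {d : ℤ} {θ : AlgebraicClosure E}
    (hθ : θ ^ 2 = algebraMap K (AlgebraicClosure E) d) (a b : absoluteGaloisGroup E) :
    (AlgEquiv.restrictScalars K (show AlgebraicClosure E ≃ₐ[E] AlgebraicClosure E from a⁻¹ * b * a * b⁻¹)) θ = θ := by
  set f : absoluteGaloisGroup E → AlgebraicClosure E → AlgebraicClosure E :=
    fun g t ↦ (AlgEquiv.restrictScalars K (show AlgebraicClosure E ≃ₐ[E] AlgebraicClosure E from g)) t with hf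
  have hmul : ∀ (x y : absoluteGaloisGroup E) (t : AlgebraicClosure E), f (x * y) t = f x (f y t) := fun _ _ _ ↦ rfl
  have hone : ∀ t : AlgebraicClosure E, f 1 t = t := fun _ ↦ rfl
  have hneg : ∀ (x : absoluteGaloisGroup E) (t : AlgebraicClosure E), f x (-t) = -f x t := fun x t ↦ map_neg _ _
  have hsign : ∀ g : absoluteGaloisGroup E, f g θ = θ ∨ f g θ = -θ := fun g ↦ restrictScalars_apply_sqrt_eq_or (K := K) hθ g
  -- the inverse has the same sign
  have key : ∀ g : absoluteGaloisGroup E, (f g θ = θ ∧ f g⁻¹ θ = θ) ∨ (f g θ = -θ ∧ f g⁻¹ θ = -θ) := by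
    intro g
    have hgg : f g⁻¹ (f g θ) = θ := by rw [← hmul, inv_mul_cancel, hone]
    rcases hsign g with h | h
    · left; refine ⟨h, ?_⟩; rwa [h] at hgg
    · right; refine ⟨h, ?_⟩
      rw [h, hneg, neg_eq_iff_eq_neg] at hgg
      exact hgg
  change f (a⁻¹ * b * a * b⁻¹) θ = θ
  rw [hmul, hmul, hmul]
  rcases key a with ⟨ha, ha'⟩ | ⟨ha, ha'⟩ <;> rcases key b with ⟨hb, hb'⟩ | ⟨hb, hb'⟩ <;>
    simp only [ha, ha', hb, hb', hneg, neg_neg]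

/-- `3` is a unit of `ℤ₂`. [folklore] -/
theorem isUnit_three_padicInt_two : IsUnit ((3 : ℤ) : ℤ_[2]) := by
  rw [PadicInt.isUnit_iff]
  refine le_antisymm (PadicInt.norm_le_one _) (not_lt.mp fun h ↦ ?_)
  rw [PadicInt.norm_int_lt_one_iff_dvd] at h
  omega

/-- A non-zero `2`-primary element has a non-zero multiple killed by `2`. [folklore] -/
theorem exists_nsmul_ne_zero_two_nsmul_eq_zero {M : Type*} [AddCommGroup M] {a : M} (ha : a ≠ 0)
    (hk : ∃ k : ℕ, 2 ^ k • a = 0) : ∃ m : ℕ, 2 ^ m • a ≠ 0 ∧ 2 • (2 ^ m • a) = 0 := by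
  classical
  have h0 : ¬ (2 ^ 0 • a = 0) := by rwa [pow_zero, one_nsmul]
  have hpos : 0 < Nat.find hk := Nat.pos_of_ne_zero fun h ↦ h0 (h ▸ Nat.find_spec hk)
  refine ⟨Nat.find hk - 1, Nat.find_min hk (Nat.sub_lt hpos one_pos), ?_⟩
  rw [← mul_nsmul', ← pow_succ', Nat.sub_one_add_one_eq_of_pos hpos]
  exact Nat.find_spec hk

/-- **THE IDENTIFICATION.** On the road-α frame at the pinned `v` (with the local untwisting `T : E(K̄_v) ≃ cm7_K(K̄_v)`
equivariant on the stabiliser of `θ = √d ∈ K̄_v`): a `2`-power torsion point `x ∈ E[2^∞]` whose local image satisfies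
`T(x) ∈ cm7_K,₁(K̄_v)` lies in `W*′ = E[𝔮_{1−r}^∞]`. [cite: GreenbergLNM1716, §2 Prop. 2.2] [cite: SilvermanAEC2009, VIII §1 and Prop. VII.2.1]
[cite: Rubin1999, §3 Lemma 3.6 (ii)] -/
theorem mem_eigen_of_untwist_mem_localKernelOfReduction {d : ℤ} (hd0 : d ≠ 0) (W : WeierstrassCurve ℚ) [W.IsElliptic]
    (C : VariableChange ℚ) (hCW : C • W = cm7.quadraticTwist (d : ℚ)) (hK : IsImaginaryQuadratic K)
    {v vbar : HeightOneSpectrum (𝓞 K)} (hv : ((2 : ℕ) : 𝓞 K) ∈ v.asIdeal) (hvbar : ((2 : ℕ) : 𝓞 K) ∈ vbar.asIdeal) (hne : vbar ≠ v)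
    (π : (W.baseChange K).endRing) (hrel : (π : AddMonoid.End (W.baseChange K).geomPoints) * π = π - 2)
    {r : ℤ_[2]} (hr : r * r = r - 2)
    (hpin : ∀ τ ∈ GreenbergSelmer.inertia v, ∀ x : ↥((W.baseChange K).endEigenPrimaryTorsion 2 π r), τ • x = x ∨ τ • x = -x)
    {θ : AlgebraicClosure (v.adicCompletion K)} (hθ : θ ^ 2 = algebraMap K (AlgebraicClosure (v.adicCompletion K)) d)
    (T : localPoints (W.baseChange K) (v.adicCompletion K) ≃+ localPoints (cm7.baseChange K) (v.adicCompletion K))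
    (hT : ∀ σ : absoluteGaloisGroup (v.adicCompletion K),
      (AlgEquiv.restrictScalars K (show AlgebraicClosure (v.adicCompletion K) ≃ₐ[v.adicCompletion K]
        AlgebraicClosure (v.adicCompletion K) from σ)) θ = θ → ∀ P, T (σ • P) = σ • T P)
    (x : (W.baseChange K).geomPrimaryTorsion 2)
    (hx : haveI : Fact (Nat.Prime 2) := ⟨Nat.prime_two⟩
      T (pointsMap (W.baseChange K) (v.adicCompletion K) (x : (W.baseChange K).geomPoints)) ∈
        (cm7.baseChange K).localKernelOfReduction v) :
    x ∈ (W.baseChange K).endEigenPrimaryTorsion 2 π (1 - r) := by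
  haveI : Fact (Nat.Prime 2) := ⟨Nat.prime_two⟩
  haveI : (cm7.baseChange K).IsElliptic := by rw [baseChange]; infer_instance
  have hj : W.j = -3375 := j_eq_of_smul_eq_cm7Twist hd0 W C hCW
  obtain ⟨θ7, hθ7⟩ := exists_sq_eq_neg_seven_of_cmEndo_mem_endRing W K hj π hrel
  have hdQ : (d : ℚ) ≠ 0 := by exact_mod_cast hd0
  have hK2 := hK.1
  have hr' : (1 - r) * (1 - r) = (1 - r) - 2 := by linear_combination hr
  have hgood := hasGoodReductionAt_cm7_of_two_mem (K := K) hv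
  -- the preimage `Cpre` of the kernel of reduction
  set ψ : (W.baseChange K).geomPrimaryTorsion 2 →+ localPoints (cm7.baseChange K) (v.adicCompletion K) :=
    T.toAddMonoidHom.comp ((pointsMap (W.baseChange K) (v.adicCompletion K)).comp ((W.baseChange K).geomPrimaryTorsion 2).subtype) with hψ
  have hψ_apply : ∀ y : (W.baseChange K).geomPrimaryTorsion 2, ψ y = T (pointsMap (W.baseChange K) (v.adicCompletion K) (y : (W.baseChange K).geomPoints)) := fun _ ↦ rfl
  have hψ_inj : Function.Injective ψ := fun a b h ↦ by
    rw [hψ_apply, hψ_apply] at h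
    exact Subtype.ext (pointsMapOfEmb_injective (W.baseChange K) _ (T.injective h))
  set Cpre : AddSubgroup ((W.baseChange K).geomPrimaryTorsion 2) := ((cm7.baseChange K).localKernelOfReduction v).comap ψ with hCpre
  have hmemC : ∀ y, y ∈ Cpre ↔ T (pointsMap (W.baseChange K) (v.adicCompletion K) (y : (W.baseChange K).geomPoints)) ∈ (cm7.baseChange K).localKernelOfReduction v :=
    fun y ↦ by rw [hCpre, AddSubgroup.mem_comap, hψ_apply]
  -- Silverman VIII §1 on the good curve, transported: an inertia element fixing `θ` moves every point into `Cpre`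
  have hmove : ∀ ι : absoluteGaloisGroup (v.adicCompletion K), ι ∈ absInertia (v.adicCompletion K) →
      (AlgEquiv.restrictScalars K (show AlgebraicClosure (v.adicCompletion K) ≃ₐ[(v.adicCompletion K)] AlgebraicClosure (v.adicCompletion K) from ι)) θ = θ →
      ∀ y : (W.baseChange K).geomPrimaryTorsion 2, absGaloisRestrict K (v.adicCompletion K) ι • y - y ∈ Cpre := by
    intro ι hι hιθ y
    rw [hmemC, AddSubgroup.coe_sub, map_sub, primaryComponent.coe_smul, ← resGal_eq_absGaloisRestrict, pointsMap_smul,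
      map_sub, hT ι hιθ]
    exact (cm7.baseChange K).smul_sub_mem_localKernelOfReduction_of_mem_absInertia hgood hι _
  -- pinning data: the named local types at `v`
  have hcl : ∀ τ ∈ GreenbergSelmer.inertia v, ∀ x ∈ (W.baseChange K).endEigenPrimaryTorsion 2 π r, τ • x = x ∨ τ • x = -x :=
    fun τ hτ x hx ↦ by
      rcases hpin τ hτ ⟨x, hx⟩ with h | h
      · exact Or.inl (congrArg Subtype.val h)
      · exact Or.inr (congrArg Subtype.val h)
  obtain ⟨α, -, -, hUR⟩ := endEigenPrimaryTorsion_two_localTypes_named_of_pinned W K hj hθ7 π hrel hr hdQ C hCW v hv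
    (inertiaDeg_eq_one_of_ne_two K hK2 hv hvbar hne) hcl
  -- structure of the two summands
  obtain ⟨hinf, hsup, -, -, -, -, -, -⟩ := endEigenPrimaryTorsion_two_structure W hj K hθ7 π hrel hr
  obtain ⟨-, -, -, -, hdiv', -, hgen', -⟩ := endEigenPrimaryTorsion_two_structure W hj K hθ7 π hrel hr'
  -- an inertia element `σ₁` with `χ_cyc(σ₁) = 3`; its square `j₁` fixes `θ` and `√d` and has `χ_cyc(j₁) = 9`
  obtain ⟨τ₁, hτ₁I, hτ₁χ⟩ := ZpExtension.exists_mem_inertia_cyclotomicCharacter_eq_of_split hK2 hvbar hv hne.symm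
    (adicCompletionPrime_mem_primesAbove K v) isUnit_three_padicInt_two.unit
  rw [inertia_adicCompletionPrime_eq_map_absInertia K v, Subgroup.mem_map] at hτ₁I
  obtain ⟨σ₁, hσ₁I, hστ⟩ := hτ₁I
  have hστ' : absGaloisRestrict K (v.adicCompletion K) σ₁ = τ₁ := hστ
  set j₁ : absoluteGaloisGroup (v.adicCompletion K) := σ₁ * σ₁ with hj₁
  have hj₁I : j₁ ∈ absInertia (v.adicCompletion K) := mul_mem hσ₁I hσ₁I
  have hj₁θ : (AlgEquiv.restrictScalars K (show AlgebraicClosure (v.adicCompletion K) ≃ₐ[(v.adicCompletion K)] AlgebraicClosure (v.adicCompletion K) from j₁)) θ = θ := by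
    change (AlgEquiv.restrictScalars K (show AlgebraicClosure (v.adicCompletion K) ≃ₐ[(v.adicCompletion K)] AlgebraicClosure (v.adicCompletion K) from σ₁))
      ((AlgEquiv.restrictScalars K (show AlgebraicClosure (v.adicCompletion K) ≃ₐ[(v.adicCompletion K)] AlgebraicClosure (v.adicCompletion K) from σ₁)) θ) = θ
    rcases restrictScalars_apply_sqrt_eq_or (K := K) hθ σ₁ with h | h
    · rw [h, h]
    · rw [h, map_neg, h, neg_neg]
  have hj₁sign : absGaloisRestrict K (v.adicCompletion K) j₁ • absClosureEmbedding ℚ K (WeierstrassCurve.geomSqrt (d : ℚ)) =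
      absClosureEmbedding ℚ K (WeierstrassCurve.geomSqrt (d : ℚ)) := by
    rw [hj₁, map_mul, mul_smul]
    rcases smul_absClosureEmbedding_geomSqrt_eq_or K (d : ℚ) (absGaloisRestrict K (v.adicCompletion K) σ₁) with h | h
    · rw [h, h]
    · rw [h, smul_neg, h, neg_neg]
  have hj₁0 : IsFrobPow j₁ ((0 : ℕ) : ℤ) := by exact_mod_cast isFrobPow_zero_iff_mem_absInertia.mpr hj₁I
  have hχ : ((GaloisRep.cyclotomicCharacter K 2 (absGaloisRestrict K (v.adicCompletion K) j₁) * (α⁻¹) ^ (0 : ℕ) : ℤ_[2]ˣ) : ℤ_[2]) = 9 := by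
    rw [pow_zero, mul_one, hj₁, map_mul, map_mul, hστ', hτ₁χ, Units.val_mul, IsUnit.unit_spec]
    push_cast; norm_num
  have hnine : ∀ y ∈ (W.baseChange K).endEigenPrimaryTorsion 2 π (1 - r), absGaloisRestrict K (v.adicCompletion K) j₁ • y = (9 : ℤ) • y := by
    intro y hy
    obtain ⟨k, hk⟩ := (AddCommGroup.mem_primaryComponent).mp y.2
    have hk' : 2 ^ k • y = 0 := Subtype.ext (by rw [AddSubmonoidClass.coe_nsmul, ZeroMemClass.coe_zero]; exact hk)
    refine (hUR j₁ 0 hj₁0 1 (Or.inl ⟨hj₁sign, rfl⟩)).2 k y hy hk' 9 ?_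
    rw [Int.cast_one, one_mul, hχ, show ((9 : ℤ) : ℤ_[2]) - 9 = 0 by push_cast; ring]
    exact Submodule.zero_mem _
  -- (a) `W*′ ≤ Cpre`
  have hWC : ∀ y ∈ (W.baseChange K).endEigenPrimaryTorsion 2 π (1 - r), y ∈ Cpre := by
    intro y hy
    obtain ⟨y₁, hy₁, rfl⟩ := hdiv' y hy
    obtain ⟨y₂, hy₂, rfl⟩ := hdiv' y₁ hy₁
    obtain ⟨y₃, hy₃, rfl⟩ := hdiv' y₂ hy₂
    have h8 : 2 • 2 • 2 • y₃ = absGaloisRestrict K (v.adicCompletion K) j₁ • y₃ - y₃ := by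
      rw [hnine y₃ hy₃]; abel
    rw [h8]
    exact hmove j₁ hj₁I hj₁θ y₃
  -- (b) `W* ⊓ Cpre = ⊥`
  obtain ⟨P₁, hP₁, hordP₁, hgenP₁⟩ := (cm7.baseChange K).exists_generator_localKernelOfReduction_torsion v hgood hv
    (exists_ordinaryPoint_cm7 hK2 hv hvbar hne) 1
  have h2P₁ : 2 • P₁ = 0 := by
    have h := addOrderOf_nsmul_eq_zero P₁
    rwa [hordP₁, pow_one] at h
  have hP₁eq : ∀ P ∈ (cm7.baseChange K).localKernelOfReduction v, P ≠ 0 → 2 • P = 0 → P = P₁ := by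
    intro P hP hP0 h2
    obtain ⟨c, hc⟩ := hgenP₁ P hP (by rw [pow_one, natCast_zsmul]; exact h2)
    have hc' : P = (c % 2) • P₁ := by
      rw [hc]
      conv_lhs => rw [← Nat.mod_add_div c 2]
      rw [add_nsmul, mul_comm 2 (c / 2), mul_nsmul', h2P₁, nsmul_zero, add_zero]
    rcases Nat.mod_two_eq_zero_or_one c with h0 | h1
    · rw [h0, zero_nsmul] at hc'; exact absurd hc' hP0
    · rw [h1, one_nsmul] at hc'; exact hc'
  have hdisj : ∀ a ∈ (W.baseChange K).endEigenPrimaryTorsion 2 π r, a ∈ Cpre → a = 0 := by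
    intro a haW haC
    by_contra ha0
    -- a non-zero `2`-torsion multiple `g` of `a`, in `W* ⊓ Cpre`
    obtain ⟨k, hk⟩ := (AddCommGroup.mem_primaryComponent).mp a.2
    have hk' : 2 ^ k • a = 0 := Subtype.ext (by rw [AddSubmonoidClass.coe_nsmul, ZeroMemClass.coe_zero]; exact hk)
    obtain ⟨m, hg0, hg2⟩ := exists_nsmul_ne_zero_two_nsmul_eq_zero ha0 ⟨k, hk'⟩
    set g := 2 ^ m • a with hg
    have hgW : g ∈ (W.baseChange K).endEigenPrimaryTorsion 2 π r := AddSubgroup.nsmul_mem _ haW _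
    have hgC : g ∈ Cpre := AddSubgroup.nsmul_mem _ haC _
    -- a non-zero `2`-torsion point `g′` of `W*′`, also in `Cpre`
    obtain ⟨g', hg'W, hord', -⟩ := hgen' 1
    have hg'2 : 2 • g' = 0 := by
      have h := addOrderOf_nsmul_eq_zero g'
      rwa [hord', pow_one] at h
    have hg'0 : g' ≠ 0 := by
      intro h
      rw [h, addOrderOf_zero, pow_one] at hord'
      exact absurd hord' (by norm_num)
    have hg'C : g' ∈ Cpre := hWC g' hg'W
    -- both map to the generator `P₁` of `cm7_K,₁ ∩ cm7_K[2]`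
    have hψg : ψ g = P₁ := hP₁eq _ ((hmemC g).1 hgC) (fun h ↦ hg0 (hψ_inj (by rw [h, map_zero])))
      (by rw [← map_nsmul, hg2, map_zero])
    have hψg' : ψ g' = P₁ := hP₁eq _ ((hmemC g').1 hg'C) (fun h ↦ hg'0 (hψ_inj (by rw [h, map_zero])))
      (by rw [← map_nsmul, hg'2, map_zero])
    have hgg' : g = g' := hψ_inj (hψg.trans hψg'.symm)
    have hbot : g ∈ (W.baseChange K).endEigenPrimaryTorsion 2 π r ⊓ (W.baseChange K).endEigenPrimaryTorsion 2 π (1 - r) :=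
      AddSubgroup.mem_inf.2 ⟨hgW, hgg' ▸ hg'W⟩
    rw [hinf, AddSubgroup.mem_bot] at hbot
    exact hg0 hbot
  -- (c) conclusion: decompose `x = a + b` along `W* ⊔ W*′ = ⊤`
  have hxC : x ∈ Cpre := (hmemC x).2 hx
  have hxtop : x ∈ (W.baseChange K).endEigenPrimaryTorsion 2 π r ⊔ (W.baseChange K).endEigenPrimaryTorsion 2 π (1 - r) := by
    rw [hsup]; exact AddSubgroup.mem_top x
  obtain ⟨a, ha, b, hb, hab⟩ := AddSubgroup.mem_sup.1 hxtop
  have haC : a ∈ Cpre := by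
    have h : a = x - b := by rw [← hab, add_sub_cancel_right]
    rw [h]
    exact Cpre.sub_mem hxC (hWC b hb)
  have ha0 : a = 0 := hdisj a ha haC
  rw [← hab, ha0, zero_add]
  exact hb

/-! ## §3 (L2): the `W*`-component of a Kummer cocycle vanishes at the commutators `τ₀⁻¹ σ τ₀ σ⁻¹` -/

/-- **(L2).** On the road-α frame at the pinned `v`, with `τ₀ ∈ I_{K_v}` and an equivariant map `e : E[2^∞] → W*` killing `W*′`:
for every `σ ∈ D_v = ⊤ ⊓ decomp v` and every `2ⁿ`-th root `R` of a `K`-rational point, the `W*`-component of the Kummer value at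
the commutator `j = τ₀⁻¹στ₀σ⁻¹` vanishes: `e(jR − R) = 0` (`j ∈ I_{K_v}` fixes `√d`, so by Greenberg's reduction argument on the
good curve `cm7_K` the point `jR − R` has local untwisted image in `cm7_K,₁`, whence `jR − R ∈ W*′ = ker e`).
[cite: GreenbergLNM1716, §2 Prop. 2.2] [cite: SilvermanAEC2009, VIII §1] -/
theorem e_kummerCocycle_conj_eq_zero {d : ℤ} (hd0 : d ≠ 0) (W : WeierstrassCurve ℚ) [W.IsElliptic]
    (C : VariableChange ℚ) (hCW : C • W = cm7.quadraticTwist (d : ℚ)) (hK : IsImaginaryQuadratic K)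
    {v vbar : HeightOneSpectrum (𝓞 K)} (hv : ((2 : ℕ) : 𝓞 K) ∈ v.asIdeal) (hvbar : ((2 : ℕ) : 𝓞 K) ∈ vbar.asIdeal) (hne : vbar ≠ v)
    (π : (W.baseChange K).endRing) (hrel : (π : AddMonoid.End (W.baseChange K).geomPoints) * π = π - 2)
    {r : ℤ_[2]} (hr : r * r = r - 2)
    (hpin : ∀ τ ∈ GreenbergSelmer.inertia v, ∀ x : ↥((W.baseChange K).endEigenPrimaryTorsion 2 π r), τ • x = x ∨ τ • x = -x)
    {τ₀ : absoluteGaloisGroup (v.adicCompletion K)} (hτ₀ : τ₀ ∈ absInertia (v.adicCompletion K))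
    (e : (W.baseChange K).geomPrimaryTorsion 2 →+ ↥((W.baseChange K).endEigenPrimaryTorsion 2 π r))
    (he0 : ∀ x ∈ (W.baseChange K).endEigenPrimaryTorsion 2 π (1 - r), e x = 0)
    {σ : absoluteGaloisGroup K} (hσ : σ ∈ (⊤ ⊓ decomp v : Subgroup (absoluteGaloisGroup K)))
    (n : ℕ) (R : (W.baseChange K).geomPoints)
    (hR : haveI : Fact (Nat.Prime 2) := ⟨Nat.prime_two⟩
      ∀ g : absoluteGaloisGroup K, g • (2 ^ n • R) = 2 ^ n • R) :
    haveI : Fact (Nat.Prime 2) := ⟨Nat.prime_two⟩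
    e (((W.baseChange K).kummerCocycle 2 n R hR).1
      ((absGaloisRestrict K (v.adicCompletion K) τ₀)⁻¹ * σ * absGaloisRestrict K (v.adicCompletion K) τ₀ * σ⁻¹)) = 0 := by
  haveI : Fact (Nat.Prime 2) := ⟨Nat.prime_two⟩
  -- a local lift of `σ` and the commutator `j`
  obtain ⟨σl, hσl⟩ := (mem_decomp_iff v σ).1 (Subgroup.mem_inf.1 hσ).2
  set j : absoluteGaloisGroup (v.adicCompletion K) := τ₀⁻¹ * σl * τ₀ * σl⁻¹ with hj
  have hjres : absGaloisRestrict K (v.adicCompletion K) j = (absGaloisRestrict K (v.adicCompletion K) τ₀)⁻¹ * σ * absGaloisRestrict K (v.adicCompletion K) τ₀ * σ⁻¹ := by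
    rw [hj, map_mul, map_mul, map_mul, map_inv, map_inv, hσl]
  have hjI : j ∈ absInertia (v.adicCompletion K) := by
    have h1 : σl * τ₀ * σl⁻¹ ∈ absInertia (v.adicCompletion K) := Subgroup.Normal.conj_mem inferInstance τ₀ hτ₀ σl
    have h2 : j = τ₀⁻¹ * (σl * τ₀ * σl⁻¹) := by rw [hj]; group
    rw [h2]
    exact mul_mem (inv_mem hτ₀) h1
  -- the local untwisting, equivariant at `j`
  obtain ⟨θ, T, hθ, -, hT⟩ := exists_localUntwist (K := K) hd0 W C hCW (v.adicCompletion K)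
  have hjθ := restrictScalars_conjWord_apply_sqrt (K := K) hθ τ₀ σl
  -- the Kummer value at `j`, read in `cm7_K(K̄_v)`, lies in the kernel of reduction
  rw [← hjres]
  apply he0
  apply mem_eigen_of_untwist_mem_localKernelOfReduction hd0 W C hCW hK hv hvbar hne π hrel hr hpin hθ T hT
  haveI : (cm7.baseChange K).IsElliptic := by rw [baseChange]; infer_instance
  rw [coe_kummerCocycle_apply, map_sub, ← resGal_eq_absGaloisRestrict, pointsMap_smul, map_sub, hT j hjθ]
  exact (cm7.baseChange K).smul_sub_mem_localKernelOfReduction_of_mem_absInertia (hasGoodReductionAt_cm7_of_two_mem hv) hjI _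

end Summit.BirchSwinnertonDyer.BirchSwinnertonDyer.Theorems.PrintCf2.CMPrimes

end
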